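import Mathlib

/-!
# `FeketeSOS.SublinearShadow` (stmt-ValiantsHypothesis-14990), line `Sketch`, reshape 5 — stub `stub_conicParam`

**Parametrisation of the conic `P · P' = R²` in `ℂ[X]`.**  If `P P' = R²` in the UFD `ℂ[X]`, then with
`D := gcd P P'` one has `P = D P₁`, `P' = D P₁'` with `gcd P₁ P₁'` a unit; `D² ∣ R²` forces `D ∣ R`
(`ℂ[X]` is integrally closed), so `R = D R₁` and `P₁ P₁' = R₁²`; coprime factors of a square are squares
up to units (`exists_associated_pow_of_mul_eq_pow`), and the units of `ℂ[X]` are the non-zero constants, so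
`P₁ = u M²`, `P₁' = u' N²`; finally `R₁² = (u u') (M N)²` and `ℂ` is algebraically closed, so `R₁ = w M N`
with `w² = u u'`.  The fully degenerate case `P = P' = 0` (then `R = 0`) is handled separately.
-/

namespace Summit.ValiantsHypothesis.ValiantsHypothesis.Theorems.SublinearShadowSketch

-- `Summit.ValiantsHypothesis.ValiantsHypothesis.…` is the tree's mandated single-conjunct layout (Sub = Summit).
set_option linter.dupNamespace false

open Polynomial Finset IsLocalRing Matrix

/-- A polynomial associated (in `ℂ[X]`) to `Q` is a constant multiple of `Q`. -/
theorem cp_eq_C_mul_of_associated {Q P₁ : ℂ[X]} (h : Associated Q P₁) : ∃ u : ℂ, P₁ = C u * Q := by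
  obtain ⟨U, hU⟩ := h
  obtain ⟨r, -, hr⟩ := Polynomial.isUnit_iff.mp U.isUnit
  exact ⟨r, by rw [← hU, ← hr, mul_comm]⟩

/-- Square roots of `C c * S ^ 2` in `ℂ[X]` are of the form `C w * S`. -/
theorem cp_sqrt {R₁ S : ℂ[X]} {c : ℂ} (h : R₁ ^ 2 = C c * S ^ 2) : ∃ w : ℂ, R₁ = C w * S := by
  obtain ⟨v, hv⟩ := IsAlgClosed.exists_pow_nat_eq c two_pos
  have h' : R₁ ^ 2 = (C v * S) ^ 2 := by rw [h, ← hv, mul_pow, C_pow]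
  rcases sq_eq_sq_iff_eq_or_eq_neg.mp h' with h1 | h1
  · exact ⟨v, h1⟩
  · exact ⟨-v, by rw [h1, C_neg, neg_mul]⟩

/-- Main case of the parametrisation, with the common factor `D ≠ 0` already extracted:
`P = D P₁`, `P' = D P₁'`, `gcd P₁ P₁'` a unit. -/
theorem cp_main {P P' R D P₁ P₁' : ℂ[X]} (h : P * P' = R ^ 2) (hD0 : D ≠ 0) (hP₁ : P = D * P₁)
    (hP₁' : P' = D * P₁') (hunit : IsUnit (gcd P₁ P₁')) :
    ∃ (M N : ℂ[X]) (u u' w : ℂ),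
      P = C u * (D * M ^ 2) ∧ P' = C u' * (D * N ^ 2) ∧ R = C w * (D * (M * N)) := by
  have hDR : D ∣ R := by
    rw [← IsIntegrallyClosed.pow_dvd_pow_iff two_ne_zero, ← h, hP₁, hP₁']
    exact ⟨P₁ * P₁', by ring⟩
  obtain ⟨R₁, hR₁⟩ := hDR
  have h1 : P₁ * P₁' = R₁ ^ 2 := by
    have h2 : D ^ 2 * (P₁ * P₁') = D ^ 2 * R₁ ^ 2 := by
      rw [← mul_pow, ← hR₁, ← h, hP₁, hP₁']
      ring
    exact mul_left_cancel₀ (pow_ne_zero 2 hD0) h2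
  obtain ⟨M, hM⟩ := exists_associated_pow_of_mul_eq_pow hunit h1
  have hunit' : IsUnit (gcd P₁' P₁) := by rwa [gcd_comm]
  obtain ⟨N, hN⟩ := exists_associated_pow_of_mul_eq_pow hunit' ((mul_comm _ _).trans h1)
  obtain ⟨u, hu⟩ := cp_eq_C_mul_of_associated hM
  obtain ⟨u', hu'⟩ := cp_eq_C_mul_of_associated hN
  have hsq : R₁ ^ 2 = C (u * u') * (M * N) ^ 2 := by
    rw [← h1, hu, hu', C_mul]
    ring
  obtain ⟨w, hw⟩ := cp_sqrt hsq
  refine ⟨M, N, u, u', w, ?_, ?_, ?_⟩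
  · rw [hP₁, hu]
    ring
  · rw [hP₁', hu']
    ring
  · rw [hR₁, hw]
    ring

/-- **Parametrisation of `P · P' = R²` in `ℂ[X]`.**  Every solution of `P P' = R²` in `ℂ[X]` is of the form
`P = u · D M²`, `P' = u' · D N²`, `R = w · D M N` with `D M N : ℂ[X]` and constants `u u' w : ℂ`. -/
theorem stub_conicParam (P P' R : ℂ[X]) (h : P * P' = R ^ 2) :
    ∃ (D M N : ℂ[X]) (u u' w : ℂ), P = C u * (D * M ^ 2) ∧ P' = C u' * (D * N ^ 2) ∧ R = C w * (D * (M * N)) := by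
  by_cases hD0 : gcd P P' = 0
  · obtain ⟨rfl, rfl⟩ := (gcd_eq_zero_iff P P').mp hD0
    have hR2 : R ^ 2 = 0 := by rw [← h, zero_mul]
    have hR : R = 0 := (pow_eq_zero_iff two_ne_zero).mp hR2
    exact ⟨0, 0, 0, 0, 0, 0, by simp, by simp, by simp [hR]⟩
  obtain ⟨P₁, P₁', hP₁, hP₁', hunit⟩ := extract_gcd P P'
  obtain ⟨M, N, u, u', w, h₁, h₂, h₃⟩ := cp_main h hD0 hP₁ hP₁' hunit
  exact ⟨gcd P P', M, N, u, u', w, h₁, h₂, h₃⟩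

end Summit.ValiantsHypothesis.ValiantsHypothesis.Theorems.SublinearShadowSketch
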